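import Mathlib
import Summits.Langlands.Langlands.Theses.TrigonalHeartLimit
import Summits.Langlands.Langlands.Theorems.TrigonalHeartLimitHeartTwistedTensorIso
import Literature.GroupTheory.SpecificGroups.AlternatingSixPSL2Nine
import HarnessLib

/-!
# The heart of `𝔽₃[six points]` is the twisted tensor square `W ⊗ W^{(3)}` of `SL₂(𝔽₉)`

Proves the route item `Summit.Langlands.Langlands.Theses.TrigonalHeartLimit.HeartTwistedTensor`
(`stmt-Langlands-12741`, support of route `TrigonalHeartLimit`, hypothesis `hH` of its deciding
theorem): there are a homomorphism `φ : SL₂(𝔽₉) → S₆` with image `A₆` (`𝔽₉ = GaloisField 3 2`), the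
Frobenius `ψ ≠ id`, an index bijection `e : Fin 2 × Fin 2 ≃ Fin 4` and an invertible `P` with
`Heart(φ g) · P = P · e (g ⊗ g^ψ) e⁻¹` for all `g ∈ SL₂(𝔽₉)` — the `4`-dimensional heart of the
mod-`3` permutation module of six points is the twisted tensor product of the standard
representation with its Frobenius twist (the unique `4`-dimensional irreducible `3`-modular
representation of `A₆ ≅ PSL₂(9)`).

## Proof

Everything is first done over Wilson's computable model `𝔽₃[i]`
(`Literature.GroupTheory.SpecificGroups.AltSixPSL`, which proves `A₆ ≅ PSL₂(𝔽₉)` through the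
labelling `e` of the ten bisections of six letters by `ℙ¹(𝔽₉)`):

1. `phi9 : SL₂(𝔽₃[i]) →* S₆` is `A₆ ↪ S₆ ∘ Θ⁻¹ ∘ (SL₂ → PSL₂)` for the isomorphism
   `Θ : A₆ ≃* PSL₂(𝔽₉)` of part II of that file, rebuilt here as a definition so that it comes with
   the SPECIFICATION `phi9_eq_of`: `phi9 g = σ` as soon as `σ ∈ A₆` and `e (σ • b) = g • e b` for the
   ten bisections `b` — a `decide` check; this pins `phi9` on the generators
   `u = (1 1; 0 1) ↦ (0 1 2)`, `v = (1 i; 0 1) ↦ (3 4 5)`, `w = (0 1; -1 0) ↦ (0 3)(1 2)`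
   (Wilson: `z ↦ z + 1` is `(0 1 2)`, `z ↦ z + i` is `(3 4 5)`).
2. The intertwining identity `Heart(phi9 g) · P₉ = P₉ · tw g` (with the explicit `P₉` below, found by
   solving the linear system offline, `det P₉ = 2i`) holds on `u, v, w` by `decide`, and the set of
   `g` where it holds is a subgroup because both sides are multiplicative (prelude:
   `heartMat_mul`, `tw_mul`); since `SL₂(𝔽₉) = ⟨u, v, w⟩` (prelude: `mem_closure_uvw`) it holds
   everywhere (`good_all`).
3. Transport to `GaloisField 3 2` along a ring isomorphism `f : GaloisField 3 2 ≃+* 𝔽₃[i]`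
   (Mathlib `FiniteField.ringEquivOfCardEq`): `φ = phi9 ∘ SL₂(f)`, `ψ = f⁻¹ ∘ Frob ∘ f`,
   `P = f⁻¹(P₉)`; applying `f` entrywise (injective) reduces the identity to step 2.

## References

* R. A. Wilson, *The Finite Simple Groups*, GTM 251, Springer 2009, §3.3.5. [Wilson2009]
* route file `Summits/Langlands/Langlands/Theses/TrigonalHeartLimit.lean` (item `HeartTwistedTensor`
  and the refuter/grounder evidence recorded there: GAP job `j003896`, `HeartA6.py`).
-/

set_option linter.dupNamespace false

open scoped LinearAlgebra.Projectivization MatrixGroups Pointwise Kronecker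

namespace Summit.Langlands.Langlands.Theorems.TrigonalHeartLimitHeartTwistedTensor

open Literature.GroupTheory.SpecificGroups Literature.GroupTheory.SpecificGroups.AltSixPSL

/-! ### The intertwining identity on all of `SL₂(𝔽₉)` -/

/-- The intertwining identity at `1`. [folklore] -/
theorem good_one : heartMat F9 (phi9 1) * P9 = P9 * tw ((1 : SL(2, F9)) : Matrix (Fin 2) (Fin 2) F9) := by
  rw [map_one, heartMat_one, Matrix.SpecialLinearGroup.coe_one, tw_one, Matrix.one_mul,
    Matrix.mul_one]

/-- The intertwining identity is stable under products (both sides are multiplicative).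
[folklore] -/
theorem good_mul {g h : SL(2, F9)}
    (hg : heartMat F9 (phi9 g) * P9 = P9 * tw (g : Matrix (Fin 2) (Fin 2) F9))
    (hh : heartMat F9 (phi9 h) * P9 = P9 * tw (h : Matrix (Fin 2) (Fin 2) F9)) :
    heartMat F9 (phi9 (g * h)) * P9 = P9 * tw ((g * h : SL(2, F9)) : Matrix (Fin 2) (Fin 2) F9) := by
  rw [map_mul, heartMat_mul, Matrix.SpecialLinearGroup.coe_mul, tw_mul, Matrix.mul_assoc, hh,
    ← Matrix.mul_assoc, hg, Matrix.mul_assoc]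

/-- The intertwining identity is stable under inverses. [folklore] -/
theorem good_inv {g : SL(2, F9)}
    (hg : heartMat F9 (phi9 g) * P9 = P9 * tw (g : Matrix (Fin 2) (Fin 2) F9)) :
    heartMat F9 (phi9 g⁻¹) * P9 = P9 * tw ((g⁻¹ : SL(2, F9)) : Matrix (Fin 2) (Fin 2) F9) := by
  have h1 : heartMat F9 (phi9 g⁻¹) * heartMat F9 (phi9 g) = 1 := by
    rw [← heartMat_mul, ← map_mul, inv_mul_cancel, map_one, heartMat_one]
  have h2 : tw (g : Matrix (Fin 2) (Fin 2) F9) * tw ((g⁻¹ : SL(2, F9)) : Matrix (Fin 2) (Fin 2) F9)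
      = 1 := by
    rw [← tw_mul, ← Matrix.SpecialLinearGroup.coe_mul, mul_inv_cancel,
      Matrix.SpecialLinearGroup.coe_one, tw_one]
  calc heartMat F9 (phi9 g⁻¹) * P9
      = heartMat F9 (phi9 g⁻¹) * P9 * (tw (g : Matrix (Fin 2) (Fin 2) F9) *
          tw ((g⁻¹ : SL(2, F9)) : Matrix (Fin 2) (Fin 2) F9)) := by rw [h2, Matrix.mul_one]
    _ = heartMat F9 (phi9 g⁻¹) * (heartMat F9 (phi9 g) * P9) *
          tw ((g⁻¹ : SL(2, F9)) : Matrix (Fin 2) (Fin 2) F9) := by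
        rw [hg]; simp only [Matrix.mul_assoc]
    _ = P9 * tw ((g⁻¹ : SL(2, F9)) : Matrix (Fin 2) (Fin 2) F9) := by
        rw [← Matrix.mul_assoc, h1, Matrix.one_mul]

/-- **`Heart(φ₉ g) · P₉ = P₉ · tw(g)` for every `g ∈ SL₂(𝔽₉)`** (generators by `decide`, then
`SL₂(𝔽₉) = ⟨u, v, w⟩` and `Subgroup.closure_induction`). [this route] -/
theorem good_all (g : SL(2, F9)) :
    heartMat F9 (phi9 g) * P9 = P9 * tw (g : Matrix (Fin 2) (Fin 2) F9) := by
  refine Subgroup.closure_induction (p := fun x _ =>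
      heartMat F9 (phi9 x) * P9 = P9 * tw (x : Matrix (Fin 2) (Fin 2) F9))
    ?_ good_one (fun x y _ _ hx hy => good_mul hx hy) (fun x _ hx => good_inv hx)
    (mem_closure_uvw g)
  intro x hx
  simp only [Set.mem_insert_iff, Set.mem_singleton_iff] at hx
  rcases hx with rfl | rfl | rfl
  · rw [phi9_gU]; exact cert_U
  · rw [phi9_gV]; exact cert_V
  · rw [phi9_gW]; exact cert_W

/-! ### Transport to `GaloisField 3 2` -/

/-- The heart matrix has entries `0, ±1`: it is preserved by ring homomorphisms. [folklore] -/
theorem heartMat_map {R S : Type*} [Ring R] [Ring S] (f : R →+* S) (σ : Equiv.Perm (Fin 6)) :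
    (heartMat R σ).map f = heartMat S σ := by
  ext i j
  simp only [heartMat, Matrix.map_apply, Matrix.of_apply, map_sub, apply_ite f, map_one, map_neg,
    map_zero]

/-- The intertwining identity transported along a ring isomorphism `f : K ≃+* 𝔽₃[i]`: with
`φ = φ₉ ∘ SL₂(f)`, `ψ = f⁻¹ ∘ Frob ∘ f` and `P = f⁻¹(P₉)`. [this route] -/
theorem transport {K : Type} [Field K] (f : K ≃+* F9) (g : SL(2, K)) :
    heartMat K (phi9 (Matrix.SpecialLinearGroup.map (f : K →+* F9) g)) *
        P9.map (f.symm : F9 → K) =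
      P9.map (f.symm : F9 → K) * Matrix.reindex eIdx eIdx (Matrix.kronecker
        (g : Matrix (Fin 2) (Fin 2) K) ((g : Matrix (Fin 2) (Fin 2) K).map
          ((f.symm : F9 →+* K).comp ((starRingEnd F9).comp (f : K →+* F9))))) := by
  have hinj : Function.Injective
      (fun M : Matrix (Fin 4) (Fin 4) K => M.map ((f : K →+* F9) : K → F9)) := by
    intro M N hMN
    ext i j
    exact f.injective (by simpa using congr_fun (congr_fun hMN i) j)
  apply hinj
  dsimp only
  have kronecker_map : ∀ A B : Matrix (Fin 2) (Fin 2) K,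
      (Matrix.kronecker A B).map ((f : K →+* F9) : K → F9) =
        Matrix.kronecker (A.map ((f : K →+* F9) : K → F9)) (B.map ((f : K →+* F9) : K → F9)) := by
    intro A B
    ext ⟨i, i'⟩ ⟨j, j'⟩
    simp [Matrix.kronecker, map_mul]
  have reindex_map : ∀ M : Matrix (Fin 2 × Fin 2) (Fin 2 × Fin 2) K,
      (Matrix.reindex eIdx eIdx M).map ((f : K →+* F9) : K → F9) =
        Matrix.reindex eIdx eIdx (M.map ((f : K →+* F9) : K → F9)) := fun M => rfl
  have hP : (P9.map (f.symm : F9 → K)).map ((f : K →+* F9) : K → F9) = P9 := by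
    rw [Matrix.map_map]
    have : ((f : K →+* F9) : K → F9) ∘ (f.symm : F9 → K) = id := funext fun x => f.apply_symm_apply x
    rw [this, Matrix.map_id]
  have hψ : ((f : K →+* F9) : K → F9) ∘ ⇑((f.symm : F9 →+* K).comp ((starRingEnd F9).comp
      (f : K →+* F9))) = star ∘ ((f : K →+* F9) : K → F9) := by
    funext x
    show f (f.symm (starRingEnd F9 (f x))) = star (f x)
    rw [f.apply_symm_apply, starRingEnd_apply]
  rw [Matrix.map_mul, Matrix.map_mul, hP, heartMat_map, reindex_map, kronecker_map, Matrix.map_map,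
    hψ, ← Matrix.map_map]
  exact good_all (Matrix.SpecialLinearGroup.map (f : K →+* F9) g)

/-! ### The route item -/

/-- **`HeartTwistedTensor`** (`stmt-Langlands-12741`): the heart of the mod-`3` permutation module
of six points, restricted to `SL₂(𝔽₉)` along `SL₂(𝔽₉) → PSL₂(𝔽₉) ≅ A₆ ≤ S₆`, is `W ⊗ W^{(3)}` —
with the explicit homomorphism `φ = φ₉ ∘ SL₂(f)`, the Frobenius `ψ`, `e = (a, b) ↦ 2a + b` and the
intertwiner `P = f⁻¹(P₉)`. [this route] -/
theorem heartTwistedTensor :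
    Summit.Langlands.Langlands.Theses.TrigonalHeartLimit.HeartTwistedTensor := by
  letI : Fintype (GaloisField 3 2) := Fintype.ofFinite _
  have hcard : Fintype.card (GaloisField 3 2) = Fintype.card F9 := by
    rw [← Nat.card_eq_fintype_card, GaloisField.card 3 2 (by decide), card_F9]
    norm_num
  let f : GaloisField 3 2 ≃+* F9 := FiniteField.ringEquivOfCardEq hcard
  let F : SL(2, GaloisField 3 2) →* SL(2, F9) :=
    Matrix.SpecialLinearGroup.map (f : GaloisField 3 2 →+* F9)
  have hF : Function.Surjective F := fun g' =>
    ⟨Matrix.SpecialLinearGroup.map (f.symm : F9 →+* GaloisField 3 2) g', Subtype.ext (by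
      ext i j
      exact f.apply_symm_apply _)⟩
  refine ⟨phi9.comp F, (f.symm : F9 →+* GaloisField 3 2).comp ((starRingEnd F9).comp
    (f : GaloisField 3 2 →+* F9)), eIdx, P9.map (f.symm : F9 → GaloisField 3 2), ?_, ?_, ?_,
    fun g => transport f g⟩
  · rw [MonoidHom.range_comp, MonoidHom.range_eq_top.mpr hF, ← MonoidHom.range_eq_map, phi9_range]
  · intro h
    have h1 := RingHom.congr_fun h (f.symm (el 0 1))
    have h2 : f.symm (starRingEnd F9 (f (f.symm (el 0 1)))) = f.symm (el 0 1) := h1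
    rw [f.apply_symm_apply, starRingEnd_apply] at h2
    have star_el_ne : star (el 0 1) ≠ el 0 1 := by decide
    exact star_el_ne (f.symm.injective h2)
  · rw [isUnit_iff_ne_zero]
    have h : (P9.map (f.symm : F9 → GaloisField 3 2)).det = f.symm P9.det := by
      rw [show P9.map (f.symm : F9 → GaloisField 3 2) =
        (f.symm : F9 →+* GaloisField 3 2).mapMatrix P9 from rfl, ← RingHom.map_det]
      rfl
    rw [h, map_ne_zero_iff _ f.symm.injective]
    exact P9_det_ne_zero

end Summit.Langlands.Langlands.Theorems.TrigonalHeartLimitHeartTwistedTensor
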